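import Literature.Topology.FourManifolds.WhiteheadExtend
import HarnessLib

/-!
# Whitehead triangulations, the extension step (Munkres 10.4), part X3: the new chart-space complex

Continuation of `WhiteheadExtend`.  In the chart space `𝔼 n` we combine

* the standard extension `K'` (`StandardExtension.exists_standardExtension`, Munkres 7.11–7.12) of
  the subdivision `R` (the simplices of the cell complex `Ph` inside the image simplices `Λ(t)`,
  `t ∈ T₁`) of the subfamily `K₁h` (images of the faces of the simplices of `T₁`) to the whole
  image complex `Q` of the straight part, and
* the box subcomplex `Boxcx` of `Ph` (simplices inside the inner box `R₀`),

into one finite geometric simplicial complex `H` (`ComplexUnion.unionComplex`): simplices of `K'`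
inside an image simplex are `R`-simplices (`mem_R_of_subset`, via
`ComplexUnion.mem_of_convexHull_subset_biUnion`), and the other simplices of `K'` do not meet the
box.  `H` covers `Q.space ∪ R₀` and nothing more.

No named facts are introduced.
-/

open Set Function Metric Filter
open scoped Topology NNReal Manifold

noncomputable section

-- `[T2Space M]` is a section variable used by most lemmas below; per-lemma `omit` would be noise.
set_option linter.unusedSectionVars false

namespace Literature.Topology.FourManifolds

open Literature.Analysis.Convexity Literature.Analysis.Convexity.SignArrangement

local notation "𝔼 " n:arg => EuclideanSpace ℝ (Fin n)

namespace BendInput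

variable {n N : ℕ} {M : Type*} [TopologicalSpace M] [T2Space M] {I : BendInput n N M}

namespace BendSetup

variable {S : BendSetup I}

namespace ExtInput

variable (X : ExtInput S)

/-! ### The subfamily `K₁h` and its subdivision `R` -/

/-- The images of the nonempty faces of the simplices of `T₁`. [folklore] -/
def K₁h : Set (Finset (𝔼 n)) :=
  {r | ∃ t ∈ X.T₁, ∃ σ : Finset (Fin N → ℝ), σ ⊆ t ∧ σ.Nonempty ∧ S.rIm σ = r}

/-- Faces of simplices of `T₁` are straight. [folklore] -/
theorem str_of_subset_T₁ {t σ : Finset (Fin N → ℝ)} (ht : t ∈ X.T₁) (hσt : σ ⊆ t) (hne : σ.Nonempty) :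
    σ ∈ S.Str := S.str_down t (X.t₁_subset_str ht) σ hσt hne

/-- `rIm σ` is a face of `Q` for straight `σ`. [folklore] -/
theorem _root_.Literature.Topology.FourManifolds.BendInput.BendSetup.rIm_mem_Q (S : BendSetup I)
    {σ : Finset (Fin N → ℝ)} (hσ : σ ∈ S.Str) : S.rIm σ ∈ S.Q.faces := by
  classical
  refine S.mem_Q_faces.2 ⟨σ, hσ, ?_⟩
  unfold BendSetup.rIm
  congr 1

/-- Auxiliary (`k₁h_subset_Q`). [folklore] -/
theorem k₁h_subset_Q : X.K₁h ⊆ S.Q.faces := by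
  rintro _ ⟨t, ht, σ, hσt, hne, rfl⟩
  exact S.rIm_mem_Q (X.str_of_subset_T₁ ht hσt hne)

/-- Auxiliary (`k₁h_down`). [folklore] -/
theorem k₁h_down : ∀ r ∈ X.K₁h, ∀ r' ⊆ r, r'.Nonempty → r' ∈ X.K₁h := by
  classical
  rintro _ ⟨t, ht, σ, hσt, hne, rfl⟩ r' hr' hne'
  refine ⟨t, ht, σ.filter fun v => S.Λ v ∈ r', (Finset.filter_subset _ _).trans hσt, ?_, ?_⟩
  · obtain ⟨y, hy⟩ := hne'
    have hy' : y ∈ S.rIm σ := hr' hy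
    unfold BendSetup.rIm at hy'
    obtain ⟨v, hv, rfl⟩ := Finset.mem_image.1 hy'
    exact ⟨v, Finset.mem_filter.2 ⟨hv, hy⟩⟩
  · unfold BendSetup.rIm
    ext y
    simp only [Finset.mem_image, Finset.mem_filter]
    constructor
    · rintro ⟨v, ⟨-, hvr⟩, rfl⟩; exact hvr
    · intro hy
      have hy' : y ∈ S.rIm σ := hr' hy
      unfold BendSetup.rIm at hy'
      obtain ⟨v, hv, rfl⟩ := Finset.mem_image.1 hy'
      exact ⟨v, ⟨hv, hy⟩, rfl⟩

/-- The simplices of `Ph` inside some image simplex of `T₁`. [folklore] -/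
def Rset : Set (Finset (𝔼 n)) :=
  {τ | τ ∈ X.Ph.faces ∧ ∃ t ∈ X.T₁, convexHull ℝ (τ : Set (𝔼 n)) ⊆ S.Λ '' convexHull ℝ (t : Set (Fin N → ℝ))}

/-- Auxiliary (`rset_subset`). [folklore] -/
theorem rset_subset : X.Rset ⊆ X.Ph.faces := fun _ h => h.1

/-- Auxiliary (`rset_down`). [folklore] -/
theorem rset_down : ∀ τ ∈ X.Rset, ∀ τ' ⊆ τ, τ'.Nonempty → τ' ∈ X.Rset := fun _ hτ τ' hτ' hne =>
  ⟨X.Ph.down_closed hτ.1 hτ' hne, hτ.2.imp fun _ h => ⟨h.1, (convexHull_mono (by exact_mod_cast hτ')).trans h.2⟩⟩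

/-- The subdivision `R` of `K₁h`: the subcomplex of `Ph` on `Rset`. [folklore] -/
def Rcx : Geometry.SimplicialComplex ℝ (𝔼 n) := subcomplexOf X.Ph X.Rset X.rset_subset X.rset_down

/-- Auxiliary (`mem_Rcx_faces`). [folklore] -/
theorem mem_Rcx_faces {τ : Finset (𝔼 n)} : τ ∈ X.Rcx.faces ↔ τ ∈ X.Rset := Iff.rfl

/-- Auxiliary (`rcx_finite`). [folklore] -/
theorem rcx_finite : X.Rcx.faces.Finite := X.Ph_finite.subset X.rset_subset

/-- `R` lies simplexwise in `K₁h`. [folklore] -/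
theorem hRa : ∀ r ∈ X.Rcx.faces, ∃ s ∈ X.K₁h, convexHull ℝ (r : Set (𝔼 n)) ⊆ convexHull ℝ (s : Set (𝔼 n)) := by
  rintro r ⟨-, t, ht, hsub⟩
  refine ⟨S.rIm t, ⟨t, ht, t, Finset.Subset.refl t, ?_, rfl⟩, ?_⟩
  · exact Finset.card_pos.1 (by rw [ht.2.1]; exact Nat.succ_pos n)
  · rwa [S.convexHull_rIm (X.t₁_subset_str ht)]

/-- `R` covers `K₁h` simplexwise. [folklore] -/
theorem hRb : ∀ s ∈ X.K₁h, ∀ y ∈ convexHull ℝ (s : Set (𝔼 n)), ∃ r ∈ X.Rcx.faces,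
    y ∈ convexHull ℝ (r : Set (𝔼 n)) ∧ convexHull ℝ (r : Set (𝔼 n)) ⊆ convexHull ℝ (s : Set (𝔼 n)) := by
  rintro _ ⟨t, ht, σ, hσt, hne, rfl⟩ y hy
  rw [S.convexHull_rIm (X.str_of_subset_T₁ ht hσt hne)] at hy ⊢
  obtain ⟨τ, hτ, hyτ, hsub⟩ := X.Ph_refines ht hσt hy
  exact ⟨τ, ⟨hτ, t, ht, hsub.trans (image_mono (convexHull_mono (by exact_mod_cast hσt)))⟩, hyτ, hsub⟩

/-! ### The standard extension `K'` -/

/-- **The standard extension** of the subdivision `R` of `K₁h` to the image complex `Q`. [folklore] -/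
theorem exists_K' : ∃ K' : Geometry.SimplicialComplex ℝ (𝔼 n), K'.faces.Finite ∧ X.Rcx.faces ⊆ K'.faces ∧
      Kept S.Q X.K₁h ⊆ K'.faces ∧
      (∀ r ∈ K'.faces, (∃ s ∈ X.K₁h, convexHull ℝ (r : Set (𝔼 n)) ⊆ convexHull ℝ (s : Set (𝔼 n))) ∨
        ∃ u ∈ S.Q.faces, u ∉ X.K₁h ∧ convexHull ℝ (r : Set (𝔼 n)) ⊆ convexHull ℝ (u : Set (𝔼 n))) ∧
      (∀ s ∈ S.Q.faces, ∀ y ∈ convexHull ℝ (s : Set (𝔼 n)), ∃ r ∈ K'.faces,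
        y ∈ convexHull ℝ (r : Set (𝔼 n)) ∧ convexHull ℝ (r : Set (𝔼 n)) ⊆ convexHull ℝ (s : Set (𝔼 n))) ∧
      VertexDesc S.Q X.Rcx K' X.K₁h := by
  classical
  exact exists_standardExtension S.Q_finite X.k₁h_subset_Q X.k₁h_down X.rcx_finite X.hRa X.hRb

/-- The standard extension. [folklore] -/
def K' : Geometry.SimplicialComplex ℝ (𝔼 n) := X.exists_K'.choose

/-- Auxiliary (`K'_finite`). [folklore] -/
theorem K'_finite : X.K'.faces.Finite := X.exists_K'.choose_spec.1

/-- Auxiliary (`rcx_subset_K'`). [folklore] -/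
theorem rcx_subset_K' : X.Rcx.faces ⊆ X.K'.faces := X.exists_K'.choose_spec.2.1

/-- Auxiliary (`kept_subset_K'`). [folklore] -/
theorem kept_subset_K' : Kept S.Q X.K₁h ⊆ X.K'.faces := X.exists_K'.choose_spec.2.2.1

/-- Auxiliary (`K'_refines`). [folklore] -/
theorem K'_refines {r : Finset (𝔼 n)} (hr : r ∈ X.K'.faces) :
    (∃ s ∈ X.K₁h, convexHull ℝ (r : Set (𝔼 n)) ⊆ convexHull ℝ (s : Set (𝔼 n))) ∨
      ∃ u ∈ S.Q.faces, u ∉ X.K₁h ∧ convexHull ℝ (r : Set (𝔼 n)) ⊆ convexHull ℝ (u : Set (𝔼 n)) :=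
  X.exists_K'.choose_spec.2.2.2.1 r hr

/-- Auxiliary (`K'_covers`). [folklore] -/
theorem K'_covers {s : Finset (𝔼 n)} (hs : s ∈ S.Q.faces) {y : 𝔼 n} (hy : y ∈ convexHull ℝ (s : Set (𝔼 n))) :
    ∃ r ∈ X.K'.faces, y ∈ convexHull ℝ (r : Set (𝔼 n)) ∧ convexHull ℝ (r : Set (𝔼 n)) ⊆ convexHull ℝ (s : Set (𝔼 n)) :=
  X.exists_K'.choose_spec.2.2.2.2.1 s hs y hy

/-- Auxiliary (`K'_vertexDesc`). [folklore] -/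
theorem K'_vertexDesc : VertexDesc S.Q X.Rcx X.K' X.K₁h := X.exists_K'.choose_spec.2.2.2.2.2

/-- **Simplices of `K'` inside an image simplex of `T₁` are `R`-simplices.** [folklore] -/
theorem mem_R_of_subset {r : Finset (𝔼 n)} (hr : r ∈ X.K'.faces) {t : Finset (Fin N → ℝ)} (ht : t ∈ X.T₁)
    (h : convexHull ℝ (r : Set (𝔼 n)) ⊆ S.Λ '' convexHull ℝ (t : Set (Fin N → ℝ))) : r ∈ X.Rcx.faces := by
  refine mem_of_convexHull_subset_biUnion (K := X.K') (A := X.Rcx.faces) X.rcx_subset_K' X.rset_down hr ?_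
  intro y hy
  obtain ⟨τ, hτ, hyτ, hsub⟩ := X.Ph_refines ht (Finset.Subset.refl t) (h hy)
  exact mem_iUnion₂.2 ⟨τ, ⟨hτ, t, ht, hsub⟩, hyτ⟩

/-- A simplex of `K'` inside the closed simplex of a member of `K₁h` is an `R`-simplex. [folklore] -/
theorem mem_R_of_subset_K₁h {r : Finset (𝔼 n)} (hr : r ∈ X.K'.faces) {s : Finset (𝔼 n)} (hs : s ∈ X.K₁h)
    (h : convexHull ℝ (r : Set (𝔼 n)) ⊆ convexHull ℝ (s : Set (𝔼 n))) : r ∈ X.Rcx.faces := by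
  obtain ⟨t, ht, σ, hσt, hne, rfl⟩ := hs
  rw [S.convexHull_rIm (X.str_of_subset_T₁ ht hσt hne)] at h
  exact X.mem_R_of_subset hr ht (h.trans (image_mono (convexHull_mono (by exact_mod_cast hσt))))

/-- A non-`K₁h` simplex of `Q` has image disjoint from the outer box. [folklore] -/
theorem disjoint_RP_of_notMem_K₁h {u : Finset (𝔼 n)} (hu : u ∈ S.Q.faces) (hnot : u ∉ X.K₁h) :
    Disjoint (convexHull ℝ (u : Set (𝔼 n))) X.RP := by
  obtain ⟨u₀, hu₀, rfl⟩ := S.mem_Q_faces.1 hu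
  rw [S.Q_hull hu₀]
  refine X.disjoint_RP_of_forall_not_subset hu₀ fun t ht hsub => hnot ⟨t, ht, u₀, hsub, S.Kb.nonempty_of_mem_faces hu₀.1, ?_⟩
  classical
  unfold BendSetup.rIm
  congr 1

/-! ### The box subcomplex and the union `H` -/

/-- The simplices of `Ph` inside the inner box. [folklore] -/
def Boxset : Set (Finset (𝔼 n)) := {τ | τ ∈ X.Ph.faces ∧ convexHull ℝ (τ : Set (𝔼 n)) ⊆ X.R₀}

/-- Auxiliary (`boxset_subset`). [folklore] -/
theorem boxset_subset : X.Boxset ⊆ X.Ph.faces := fun _ h => h.1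

/-- Auxiliary (`boxset_down`). [folklore] -/
theorem boxset_down : ∀ τ ∈ X.Boxset, ∀ τ' ⊆ τ, τ'.Nonempty → τ' ∈ X.Boxset := fun _ hτ τ' hτ' hne =>
  ⟨X.Ph.down_closed hτ.1 hτ' hne, (convexHull_mono (by exact_mod_cast hτ')).trans hτ.2⟩

/-- The box subcomplex of `Ph`. [folklore] -/
def Boxcx : Geometry.SimplicialComplex ℝ (𝔼 n) := subcomplexOf X.Ph X.Boxset X.boxset_subset X.boxset_down

/-- Auxiliary (`mem_Boxcx_faces`). [folklore] -/
theorem mem_Boxcx_faces {τ : Finset (𝔼 n)} : τ ∈ X.Boxcx.faces ↔ τ ∈ X.Boxset := Iff.rfl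

/-- **Compatibility of `K'` with the box subcomplex**: their simplices meet in common faces.
[folklore] -/
theorem compat : ∀ r ∈ X.K'.faces, ∀ τ ∈ X.Boxcx.faces,
    convexHull ℝ (r : Set (𝔼 n)) ∩ convexHull ℝ (τ : Set (𝔼 n)) ⊆ convexHull ℝ (↑(r ∩ τ) : Set (𝔼 n)) := by
  classical
  intro r hr τ hτ
  rcases X.K'_refines hr with ⟨s, hs, hsub⟩ | ⟨u, hu, hnot, hsub⟩
  · -- `r` is an `R`-simplex, hence a simplex of `Ph`, like `τ`
    have hrR := X.mem_R_of_subset_K₁h hr hs hsub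
    rw [Finset.coe_inter]
    exact X.Ph.inter_subset_convexHull hrR.1 hτ.1
  · -- `r` does not meet the box
    intro y hy
    exfalso
    exact Set.disjoint_left.1 (X.disjoint_RP_of_notMem_K₁h hu hnot) (hsub hy.1) (X.R₀_subset_RP (hτ.2 hy.2))

/-- **The new chart-space complex `H = K' ∪ Boxcx`.** [folklore] -/
def H : Geometry.SimplicialComplex ℝ (𝔼 n) := by
  classical
  exact unionComplex X.K' X.Boxcx X.compat

/-- Auxiliary (`mem_H_faces`). [folklore] -/
theorem mem_H_faces {ρ : Finset (𝔼 n)} : ρ ∈ X.H.faces ↔ ρ ∈ X.K'.faces ∨ ρ ∈ X.Boxset := by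
  classical
  show ρ ∈ (unionComplex X.K' X.Boxcx X.compat).faces ↔ _
  rw [unionComplex_faces]
  rfl

/-- Auxiliary (`H_finite`). [folklore] -/
theorem H_finite : X.H.faces.Finite := by
  have : X.H.faces ⊆ X.K'.faces ∪ X.Ph.faces := fun ρ hρ => by
    rcases X.mem_H_faces.1 hρ with h | h
    · exact Or.inl h
    · exact Or.inr h.1
  exact (X.K'_finite.union X.Ph_finite).subset this

/-- `Q.space ⊆ H.space`. [folklore] -/
theorem Q_space_subset_H : S.Q.space ⊆ X.H.space := fun y hy => by
  obtain ⟨s, hs, hys⟩ := Geometry.SimplicialComplex.mem_space_iff.1 hy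
  obtain ⟨r, hr, hyr, -⟩ := X.K'_covers hs hys
  exact X.H.convexHull_subset_space (X.mem_H_faces.2 (Or.inl hr)) hyr

/-- `R₀ ⊆ H.space`. [folklore] -/
theorem R₀_subset_H : X.R₀ ⊆ X.H.space := fun y hy => by
  have hy' : y ∈ cellSet X.L (X.J none) ∅ := by rw [X.cellSet_J_none]; exact hy
  obtain ⟨τ, hτ, hyτ, hsub⟩ := X.exists_Ph.choose_spec.2.2.2.1 y ⟨none, hy'⟩ (X.J none) ∅ hy'
  rw [X.cellSet_J_none] at hsub
  exact X.H.convexHull_subset_space (X.mem_H_faces.2 (Or.inr ⟨hτ, hsub⟩)) hyτ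

/-- Simplices of `K'` lie in `Q.space`. [folklore] -/
theorem K'_subset_Q_space {r : Finset (𝔼 n)} (hr : r ∈ X.K'.faces) : convexHull ℝ (r : Set (𝔼 n)) ⊆ S.Q.space := by
  rcases X.K'_refines hr with ⟨s, hs, hsub⟩ | ⟨u, hu, -, hsub⟩
  · exact hsub.trans (S.Q.convexHull_subset_space (X.k₁h_subset_Q hs))
  · exact hsub.trans (S.Q.convexHull_subset_space hu)

/-- `H.space = Q.space ∪ R₀`. [folklore] -/
theorem H_space : X.H.space = S.Q.space ∪ X.R₀ := by
  refine Subset.antisymm (fun y hy => ?_) (union_subset X.Q_space_subset_H X.R₀_subset_H)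
  obtain ⟨ρ, hρ, hyρ⟩ := Geometry.SimplicialComplex.mem_space_iff.1 hy
  rcases X.mem_H_faces.1 hρ with h | h
  · exact Or.inl (X.K'_subset_Q_space h hyρ)
  · exact Or.inr (h.2 hyρ)

/-- `Q.space` is the image of the straight part. [folklore] -/
theorem Q_space_eq : S.Q.space = S.Λ '' S.StrCx.space := by
  refine Subset.antisymm (fun y hy => ?_) ?_
  · obtain ⟨s, hs, hys⟩ := Geometry.SimplicialComplex.mem_space_iff.1 hy
    obtain ⟨t, ht, rfl⟩ := S.mem_Q_faces.1 hs
    rw [S.Q_hull ht] at hys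
    obtain ⟨x, hx, rfl⟩ := hys
    exact ⟨x, S.StrCx.convexHull_subset_space ht hx, rfl⟩
  · rintro _ ⟨x, hx, rfl⟩
    obtain ⟨t, ht, hxt⟩ := Geometry.SimplicialComplex.mem_space_iff.1 hx
    have h : S.Λ x ∈ S.Λ '' convexHull ℝ (t : Set (Fin N → ℝ)) := ⟨x, hxt, rfl⟩
    rw [← S.Q_hull ht] at h
    exact S.Q.convexHull_subset_space (S.mem_Q_faces.2 ⟨t, ht, rfl⟩) h

end ExtInput

end BendSetup

end BendInput

end Literature.Topology.FourManifolds
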